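import Literature.Geometry.Riemannian.RicciFlowHeatKernelFn
import Literature.Geometry.Riemannian.KernelNashEntropy
import Literature.Geometry.Riemannian.ConjugateHeatTestPairing
import Literature.Geometry.Riemannian.HeatKernelVeryWeak
import Literature.Geometry.Riemannian.HeatKernelTimeRegularity
import HarnessLib

/-!
# Sub-solutions of the heat equation are dominated by the heat kernel measures
# (Bamler 2020a, §2.3; the maximum-principle step of Hein–Naber 2014)

R. Bamler, *Entropy and heat kernel bounds on a Ricci flow background*, arXiv:2008.07093 (2020a),
§2.3: for the heat operator `□ = ∂ₜ − Δ_{g_t}` coupled with a Ricci flow on a compact manifold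
and the conjugate heat kernel measures `dν_{x,t;s} = K(x,t;·,s) dg_s`, `ν_{x,t;t} = δ_x`, one has
for every `u ∈ C²(M × [t₁, t₂])`

  `d/ds ∫_M u dν_{x,t;s} = ∫_M □u dν_{x,t;s}`

(duality `∫ (□u) v − ∫ u (□* v) = d/dt ∫ u v` with `□* K(x,t;·,·) = 0`). Consequently, if
`□u ≤ 0` (a SUB-solution of the heat equation), then `s ↦ ∫ u(·, s) dν_{x,t;s}` is
non-increasing, and letting `s ↗ t` (`ν_{x,t;s} → δ_x`) gives `u(x, t) ≤ ∫ u(·, s) dν_{x,t;s}`: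
the "maximum principle" step by which Bamler 2020a (§2.3 Lemma 2, §4, §11–12) and Hein–Naber
2014 (§3.1, the homotopy principle `d/dt P_{t0}U_t = P_{t0}□U_t` in the proof of their Poincaré
and log-Sobolev inequalities, Thm. 1.10) turn the Bochner inequalities `□|∇u|² ≤ 0`,
`□(|∇u|²/u) ≤ 0` into gradient, Poincaré and log-Sobolev bounds for the heat kernel measures.

This file proves the statement for a Ricci flow `hflow = (h, cov)` on `[a, T]` of a `C^∞` family
of Riemannian metrics on a closed connected manifold `M` (modelled on `ℝᵐ`), with the tree's heat
kernel function `K = hflow.heatKernelFn hh hR` (`RicciFlowHeatKernelFn.lean`) and heat kernel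
measures `ν_{x,t;s} = heatKernelMeasure hh hR t x s` (`HeatKernelMeasures.lean`):

* `integral_heatKernelMeasure_anti_of_subsolution_of_lt` — for `a < s₁ < s₂ < t ≤ T` and `w`
  `C^∞` on `M × [s₁, s₂]` with `∂ₛw ≤ Δ_{h(s)} w` there (one-sided time derivatives at the end
  points), `∫ w(s₂) dν_{x,t;s₂} ≤ ∫ w(s₁) dν_{x,t;s₁}`;
* `integral_heatKernelMeasure_anti_of_subsolution` — the same for `s₂ ≤ t`, i.e. including the
  evaluation `w(x, t) ≤ ∫ w(s₁) dν_{x,t;s₁}` at the pole (`ν_{x,t;t} = δ_x`).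

Proof: `(r, y) ↦ K(x,t;y,r)` is a conjugate heat solution on `[s₁, s₂] ⊂ (a, t)`
(`isConjugateHeatSolutionOn_of_kernel`), so by the test pairing
`IsRicciFlow.hasDerivWithinAt_integral_mul_conjugateHeat` the function
`r ↦ ∫ w(r) K(x,t;·,r) dV_{h(r)} = ∫ w(r) dν_{x,t;r}` has derivative `∫ (∂ᵣw − Δw) K dV ≤ 0` within
`[s₁, s₂]`, hence is antitone there; the case `s₂ = t` follows by letting `σ ↗ t` in the case
`σ < t`, using the continuity of `s ↦ ∫ Φ(·, s) dν_{x,t;s}` for continuous `Φ` on `M × ℝ`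
(`continuous_integral_slice_heatKernelMeasure`). Everything is proved; no definitions, no named
facts. What is NOT here: super Ricci flows, non-compact `M`, and sub-solutions of lower
regularity (`C²`, or Lipschitz as in Kato's inequality `□|∇u| ≤ 0`).

## References

* R. H. Bamler, *Entropy and heat kernel bounds on a Ricci flow background*, arXiv:2008.07093
  (2020), §2.3 (display `d/dt ∫ u dν_{x₀,t₀;t} = ∫ □u dν_{x₀,t₀;t}`, Lemma 2). [Bamler2020Entropy]
* H.-J. Hein, A. Naber, *New logarithmic Sobolev inequalities and an ε-regularity theorem for the
  Ricci flow*, Comm. Pure Appl. Math. 67 (2014), 1543–1561, §3.1 (homotopy principle, proof of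
  Thm. 1.10). [HeinNaber2014]
-/

noncomputable section

open Bundle Set Function Filter Manifold MeasureTheory Measure TopologicalSpace
open scoped Manifold ContDiff Topology ENNReal NNReal

namespace Literature.Geometry.Riemannian

open Lorentzian Lorentzian.PseudoRiemannianMetric

section Subsolution

variable {m : ℕ} {H : Type*} [TopologicalSpace H]
  {I : ModelWithCorners ℝ (EuclideanSpace ℝ (Fin m)) H} [I.Boundaryless]
  {M : Type*} [TopologicalSpace M] [ChartedSpace H M] [IsManifold I ∞ M]
  [T2Space M] [CompactSpace M] [SecondCountableTopology M] [MeasurableSpace M] [BorelSpace M]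
  [PreconnectedSpace M]
  {h : ℝ → PseudoRiemannianMetric I ∞ (EuclideanSpace ℝ (Fin m)) (TangentSpace I : M → Type _)}
  {cov : ℝ → CovariantDerivative I (EuclideanSpace ℝ (Fin m)) (TangentSpace I : M → Type _)}
  {a T : ℝ}

/-- **Sub-solutions of the heat equation are dominated by the heat kernel measures, away from the
pole** (Bamler 2020a, §2.3: `d/ds ∫ u dν_{x,t;s} = ∫ □u dν_{x,t;s} ≤ 0` for `□u ≤ 0`): for a Ricci
flow `(h, cov)` on `[a, T]` of a smooth family of Riemannian metrics on a closed connected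
manifold, `a < s₁ < s₂ < t ≤ T`, `x ∈ M`, and `w` `C^∞` on `M × [s₁, s₂]` with
`∂ₛw ≤ Δ_{h(s)} w` there (time derivatives within `[s₁, s₂]`),
`∫ w(s₂) dν_{x,t;s₂} ≤ ∫ w(s₁) dν_{x,t;s₁}` (`r ↦ ∫ w(r) K(x,t;·,r) dV_{h(r)}` has derivative
`∫ (∂ᵣw − Δw) K dV ≤ 0` within `[s₁, s₂]`, `IsRicciFlow.hasDerivWithinAt_integral_mul_conjugateHeat`
with the conjugate heat solution `K(x,t;·,·)`, `isConjugateHeatSolutionOn_of_kernel`).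
[cite: Bamler2020Entropy, §2.3] -/
theorem integral_heatKernelMeasure_anti_of_subsolution_of_lt (hflow : IsRicciFlow h cov (Icc a T))
    (hh : IsContMDiffFamilyOn ∞ h univ) (hR : ∀ r, (h r).IsRiemannian) {t : ℝ} (ht : t ∈ Ioc a T)
    (x : M) {s₁ s₂ : ℝ} (has₁ : a < s₁) (h12 : s₁ < s₂) (hs₂t : s₂ < t) {w : ℝ → M → ℝ}
    (hw : ContMDiffOn (I.prod 𝓘(ℝ, ℝ)) 𝓘(ℝ, ℝ) ∞ (fun p : M × ℝ ↦ w p.2 p.1) (univ ×ˢ Icc s₁ s₂))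
    (hsub : ∀ r ∈ Icc s₁ s₂, ∀ y : M,
      derivWithin (fun r' ↦ w r' y) (Icc s₁ s₂) r ≤ (h r).laplaceBeltrami (w r) y) :
    ∫ y, w s₂ y ∂(heatKernelMeasure hh hR t x s₂) ≤
      ∫ y, w s₁ y ∂(heatKernelMeasure hh hR t x s₁) := by
  -- the kernel `K = K(x,t;·,·)`, a conjugate heat solution on `[s₁, s₂] ⊂ (a, t)`
  set K : M × ℝ → ℝ := hflow.heatKernelFn hh hR t x with hKdef
  have hKs : ContMDiffOn (I.prod 𝓘(ℝ, ℝ)) 𝓘(ℝ, ℝ) ∞ K (univ ×ˢ Ioo a t) :=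
    hflow.heatKernelFn_contMDiffOn hh hR ht x
  have hKpde : ∀ p ∈ univ ×ˢ Ioo a t, deriv (fun s ↦ K (p.1, s)) p.2 =
      -(h p.2).laplaceBeltrami (fun y ↦ K (y, p.2)) p.1 +
        (h p.2).scalarCurvatureWith (cov p.2) p.1 * K p := fun p hp ↦
    hflow.deriv_heatKernelFn_time hh hR ht x hp
  have hsol : IsConjugateHeatSolutionOn h cov (Icc s₁ s₂) fun r y ↦ K (y, r) :=
    isConjugateHeatSolutionOn_of_kernel hKs hKpde has₁ h12 hs₂t
  have hflow' : IsRicciFlow h cov (Icc s₁ s₂) :=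
    hflow.mono (Icc_subset_Icc has₁.le (hs₂t.le.trans ht.2))
  -- `Ψ r = ∫ w(r) K(·, r) dV_{h(r)}` has derivative `D r = ∫ (∂ᵣw − Δw) K dV ≤ 0` within `[s₁, s₂]`
  set Ψ : ℝ → ℝ := fun r ↦ ∫ y, w r y * K (y, r) ∂(h r).riemVolume with hΨ
  set D : ℝ → ℝ := fun r ↦ ∫ y, (derivWithin (fun r' ↦ w r' y) (Icc s₁ s₂) r -
    (h r).laplaceBeltrami (w r) y) * K (y, r) ∂(h r).riemVolume with hD
  have hderiv : ∀ r ∈ Icc s₁ s₂, HasDerivWithinAt Ψ (D r) (Icc s₁ s₂) r := fun r hr ↦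
    hflow'.hasDerivWithinAt_integral_mul_conjugateHeat h12 (fun r _ ↦ hR r) hw hsol hr
  have hcont : ContinuousOn Ψ (Icc s₁ s₂) := fun r hr ↦ (hderiv r hr).continuousWithinAt
  have hDle : ∀ r ∈ Icc s₁ s₂, D r ≤ 0 := by
    intro r hr
    refine integral_nonpos fun y ↦ ?_
    have hK0 : 0 < K (y, r) :=
      hflow.heatKernelFn_pos hh hR ht x ⟨mem_univ _, has₁.trans_le hr.1, hr.2.trans_lt hs₂t⟩
    exact mul_nonpos_of_nonpos_of_nonneg (sub_nonpos.2 (hsub r hr y)) hK0.le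
  have hanti : AntitoneOn Ψ (Icc s₁ s₂) :=
    antitoneOn_of_hasDerivWithinAt_nonpos (convex_Icc s₁ s₂) hcont
      (fun r hr ↦ (hderiv r (interior_subset hr)).mono interior_subset)
      fun r hr ↦ hDle r (interior_subset hr)
  have key : Ψ s₂ ≤ Ψ s₁ := hanti (left_mem_Icc.2 h12.le) (right_mem_Icc.2 h12.le) h12.le
  -- `∫ w(r) dν_{x,t;r} = Ψ r` for `r ∈ (a, t)`
  rw [hflow.integral_heatKernelMeasure_eq_integral_mul_heatKernelFn hh hR ht x
      ⟨has₁.trans h12, hs₂t⟩,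
    hflow.integral_heatKernelMeasure_eq_integral_mul_heatKernelFn hh hR ht x
      ⟨has₁, h12.trans hs₂t⟩]
  exact key

/-- **Sub-solutions of the heat equation are dominated by the heat kernel measures** (Bamler
2020a, §2.3, `d/ds ∫ u dν_{x,t;s} = ∫ □u dν_{x,t;s}` and `ν_{x,t;s} → δ_x` as `s ↗ t`; the
homotopy principle `d/dt P_{t0}U_t = P_{t0}□U_t ≤ 0` of Hein–Naber 2014, §3.1): for a Ricci
flow `(h, cov)` on `[a, T]` of a smooth family of Riemannian metrics on a closed connected
manifold, `t ∈ (a, T]`, `x ∈ M`, `a < s₁ < s₂ ≤ t`, and `w` `C^∞` on `M × [s₁, s₂]` with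
`∂ₛw ≤ Δ_{h(s)} w` there (time derivatives within `[s₁, s₂]`),

  `∫ w(s₂) dν_{x,t;s₂} ≤ ∫ w(s₁) dν_{x,t;s₁}`;

for `s₂ = t` the left-hand side is `w(x, t)` (`ν_{x,t;t} = δ_x`). The case `s₂ < t` is
`integral_heatKernelMeasure_anti_of_subsolution_of_lt`; the case `s₂ = t` is its limit `σ ↗ t`
along `continuous_integral_slice_heatKernelMeasure` applied to the continuous extension
`(y, s) ↦ w(max s₁ (min s s₂), y)` of `w`. [cite: Bamler2020Entropy, §2.3]
[cite: HeinNaber2014, §3.1, homotopy principle (1) in the proof of Thm. 1.10] -/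
theorem integral_heatKernelMeasure_anti_of_subsolution (hflow : IsRicciFlow h cov (Icc a T))
    (hh : IsContMDiffFamilyOn ∞ h univ) (hR : ∀ r, (h r).IsRiemannian) {t : ℝ} (ht : t ∈ Ioc a T)
    (x : M) {s₁ s₂ : ℝ} (has₁ : a < s₁) (h12 : s₁ < s₂) (hs₂t : s₂ ≤ t) {w : ℝ → M → ℝ}
    (hw : ContMDiffOn (I.prod 𝓘(ℝ, ℝ)) 𝓘(ℝ, ℝ) ∞ (fun p : M × ℝ ↦ w p.2 p.1) (univ ×ˢ Icc s₁ s₂))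
    (hsub : ∀ r ∈ Icc s₁ s₂, ∀ y : M,
      derivWithin (fun r' ↦ w r' y) (Icc s₁ s₂) r ≤ (h r).laplaceBeltrami (w r) y) :
    ∫ y, w s₂ y ∂(heatKernelMeasure hh hR t x s₂) ≤
      ∫ y, w s₁ y ∂(heatKernelMeasure hh hR t x s₁) := by
  rcases hs₂t.lt_or_eq with hlt | heq
  · exact integral_heatKernelMeasure_anti_of_subsolution_of_lt hflow hh hR ht x has₁ h12 hlt hw
      hsub
  subst heq
  -- the statement on `[s₁, σ]` for `σ ∈ (s₁, s₂)`
  have hσ : ∀ σ ∈ Ioo s₁ s₂, ∫ y, w σ y ∂(heatKernelMeasure hh hR s₂ x σ) ≤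
      ∫ y, w s₁ y ∂(heatKernelMeasure hh hR s₂ x s₁) := by
    intro σ hσ
    have hsubI : Icc s₁ σ ⊆ Icc s₁ s₂ := Icc_subset_Icc le_rfl hσ.2.le
    refine integral_heatKernelMeasure_anti_of_subsolution_of_lt hflow hh hR ht x has₁ hσ.1 hσ.2
      (hw.mono (prod_mono le_rfl hsubI)) fun r hr y ↦ ?_
    have hd : HasDerivWithinAt (fun r' ↦ w r' y) (derivWithin (fun r' ↦ w r' y) (Icc s₁ s₂) r)
        (Icc s₁ s₂) r := hasDerivWithinAt_time_of_contMDiffOn (by simp) hw y (hsubI hr)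
    rw [(hd.mono hsubI).derivWithin (uniqueDiffOn_Icc hσ.1 r hr)]
    exact hsub r (hsubI hr) y
  -- the continuous extension `Φ (y, s) = w (clamp s) y` of `w` to `M × ℝ`
  set Φ : M × ℝ → ℝ := fun p ↦ w (max s₁ (min p.2 s₂)) p.1 with hΦ
  have hclamp : ∀ s : ℝ, max s₁ (min s s₂) ∈ Icc s₁ s₂ := fun s ↦
    ⟨le_max_left _ _, max_le h12.le (min_le_right _ _)⟩
  have hΦc : Continuous Φ := by
    have hc : Continuous fun p : M × ℝ ↦ ((p.1, max s₁ (min p.2 s₂)) : M × ℝ) :=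
      continuous_fst.prodMk (continuous_const.max (continuous_snd.min continuous_const))
    exact hw.continuousOn.comp_continuous hc fun p ↦ ⟨mem_univ _, hclamp p.2⟩
  have hΦeq : ∀ s ∈ Icc s₁ s₂, ∀ y, Φ (y, s) = w s y := by
    intro s hs y
    show w (max s₁ (min s s₂)) y = w s y
    rw [min_eq_left hs.2, max_eq_right hs.1]
  have hG : Continuous fun s ↦ ∫ y, Φ (y, s) ∂(heatKernelMeasure hh hR s₂ x s) :=
    continuous_integral_slice_heatKernelMeasure hh hR hΦc s₂ x
  have hlim : Tendsto (fun s ↦ ∫ y, Φ (y, s) ∂(heatKernelMeasure hh hR s₂ x s)) (𝓝[<] s₂)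
      (𝓝 (∫ y, Φ (y, s₂) ∂(heatKernelMeasure hh hR s₂ x s₂))) :=
    (hG.tendsto s₂).mono_left nhdsWithin_le_nhds
  have hev : ∀ᶠ s in 𝓝[<] s₂, ∫ y, Φ (y, s) ∂(heatKernelMeasure hh hR s₂ x s) ≤
      ∫ y, w s₁ y ∂(heatKernelMeasure hh hR s₂ x s₁) := by
    filter_upwards [Ioo_mem_nhdsLT h12] with s hs
    rw [integral_congr_ae (Eventually.of_forall fun y ↦ hΦeq s (Ioo_subset_Icc_self hs) y)]
    exact hσ s hs
  have hle := le_of_tendsto hlim hev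
  rwa [integral_congr_ae (Eventually.of_forall fun y ↦ hΦeq s₂ (right_mem_Icc.2 h12.le) y)]
    at hle

end Subsolution

end Literature.Geometry.Riemannian
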